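import Summits.Ventures.PercRepro.Night2LocalDGen
import Summits.Ventures.PercRepro.Night2DQm1Cell

/-!
# PercRepro — the bases-only regime modulo its target sum, and the sum in closed form (night-2, gen 19)

**`localShadowHall_dgen_of_sum`**: for a simple loopless matroid, a rank-`(q+1)` flat `G` with `|E ∖ G| = d ≤ q`,
`kColoops + 1 ≤ d`, `kColoops + ρ = q + 1`, `ρ ≥ 3`, in the bases-only regime `0 ≤ cPrimeDG` with `0 < lambdaDG`, the
local form (LI_G) holds as soon as `dgenSum n q d ρ k ≥ 1` at `n = |G ∖ K|` (the certificate of `Night2DQm1Cell`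
with the general-`d` bounds of `Night2LocalDGen`; the top `q − d + 1` levels of targets have residual capacity `1`).
**`dgenSum_eq`**: `dgenSum n q d ρ k = (c′ · Aρt(n) + T(n)) / (ρ λ C(n, ρ))` with `t = q − d + 1`,
`Aρt(n) = Σ_{i=ρ+1}^{n−t} C(n, i)` and `T(n) = Σ_{i=n+1−t}^{n} C(n, i)` (`n ≥ ρ + t`).
-/

namespace PercRepro.Shadow

open Finset PerFlat ThmH

variable {α : Type*} [DecidableEq α] {M : Matroid α} [M.Finite]

open scoped Classical in
/-- A thin member and `z ∈ G ∖ cl B` leave at least one point of `G` outside `B ∪ {z}`. -/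
theorem one_le_card_sdiff_insert {q : ℕ} {G : Finset α} (hG : G ∈ flatsQ M (q + 1)) (hd : (gr M \ G).card ≤ q)
    {B : Finset α} (hB : B ∈ thinMembers M q G) {z : α} (hz : z ∈ G \ clF M B) :
    1 ≤ (G \ insert z B).card := by
  have hB' : B ∈ membersIn M (Uq M (q + 2) q) G := (mem_thinMembers.1 hB).1
  have hBU : B ∈ Uq M (q + 2) q := (mem_membersIn.1 hB').1
  have hm := two_le_card_sdiff_of_not_lay0 hG hd hB' (mem_thinMembers.1 hB).2
  have hsub : (G \ clF M B).erase z ⊆ G \ insert z B := by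
    intro x hx
    rw [Finset.mem_erase, Finset.mem_sdiff] at hx
    rw [Finset.mem_sdiff, Finset.mem_insert]
    exact ⟨hx.2.1, fun h => h.elim hx.1 (fun hxB => hx.2.2 (subset_clF hBU hxB))⟩
  have := Finset.card_le_card hsub
  rw [Finset.card_erase_of_mem (by exact hz)] at this
  omega

open scoped Classical in
/-- **THE BASES-ONLY REGIME MODULO ITS TARGET SUM.** -/
theorem localShadowHall_dgen_of_sum {q d ρ : ℕ} {G : Finset α} (hG : G ∈ flatsQ M (q + 1))
    (hd : (gr M \ G).card = d) (hdq : d ≤ q) (hk : kColoops M G + ρ = q + 1) (hρ : 3 ≤ ρ)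
    (hkd : kColoops M G + 1 ≤ d) (hs : ∀ e ∈ gr M, ∀ f ∈ gr M, e ≠ f → rkN M {e, f} = 2)
    (hl : ∀ e ∈ gr M, M.Indep {e}) (hc : 0 ≤ cPrimeDG q d ρ (kColoops M G))
    (hlam : 0 < lambdaDG q d ρ (kColoops M G))
    (hsum : 1 ≤ DGen.dgenSum (G.card - kColoops M G) q d ρ (kColoops M G)) : LocalShadowHall M q G := by
  have hd' : (gr M \ G).card ≤ q := by omega
  apply localShadowHall_of_lossFair hG hd'
  intro B hB z hz
  by_cases hl0 : loss M q G B z = 0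
  · rw [hl0]
    exact mul_nonneg (rhoL_nonneg hG hd' B z) (lossIncome_nonneg hG hd' B z)
  have hB' : B ∈ membersIn M (Uq M (q + 2) q) G := (mem_thinMembers.1 hB).1
  have hBU : B ∈ Uq M (q + 2) q := (mem_membersIn.1 hB').1
  have hzB : z ∉ B := notMem_of_notMem_clF hBU (Finset.mem_sdiff.1 hz).2
  have hK := coloops_subset_of_mem_thinMembers hG hd' hB
  have h2 : (B \ coloops M G).card + 1 = ρ := by
    by_contra hne
    have hge := card_sdiff_coloops_thin_ge hG hd' hk hB
    exact hl0 (loss_eq_zero_of_card_ge_dgen hG hd hdq hk hc hs hl hB (by omega) hz)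
  set n := G.card - kColoops M G with hn
  have hr : (G \ insert z B).card = n - ρ := card_sdiff_insert_eq_dqm1 hG hd' hB h2 hz
  have hr1 : 1 ≤ n - ρ := by rw [← hr]; exact one_le_card_sdiff_insert hG hd' hB hz
  have hBcard : B.card = kColoops M G + (B \ coloops M G).card := by
    rw [kColoops_eq_card_coloops, ← Finset.card_union_of_disjoint Finset.disjoint_sdiff,
      Finset.union_sdiff_of_subset hK]
  have hb : (insert z B).card = q + 1 := by rw [Finset.card_insert_of_notMem hzB, hBcard]; omega
  have hT : (tgtSets M q G B z).card = 2 ^ (n - ρ) - 1 := by rw [card_tgtSets hG hB' hz, hr]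
  have hTpos : (0 : ℚ) < ((2 ^ (n - ρ) - 1 : ℕ) : ℚ) := by
    have : 2 ≤ 2 ^ (n - ρ) := by
      calc 2 = 2 ^ 1 := by norm_num
        _ ≤ 2 ^ (n - ρ) := Nat.pow_le_pow_right (by norm_num) hr1
    exact_mod_cast (by omega : 0 < 2 ^ (n - ρ) - 1)
  have hGcard : G.card = n + kColoops M G := by
    have : kColoops M G ≤ G.card := by
      rw [kColoops_eq_card_coloops]
      exact Finset.card_le_card (hK.trans ((subset_clF hBU).trans (mem_membersIn.1 hB').2))
    omega
  -- the size bounds on the targets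
  set u : ℕ → ℚ := fun s => ((ρ : ℚ) * ((s - kColoops M G).choose ρ : ℚ)) *
    (lambdaDG q d ρ (kColoops M G) / ((2 ^ (n - ρ) - 1 : ℕ) : ℚ)) with hu_def
  set v : ℕ → ℚ := fun s => if s + (q - d + 1) ≤ G.card then cPrimeDG q d ρ (kColoops M G) else 1 with hv_def
  have hKS : ∀ S ∈ tgtSets M q G B z, coloops M G ⊆ S :=
    fun S hS => coloops_subset_of_mem_shadowAt (mem_tgtSets.1 hS).1
  have hSK : ∀ S ∈ tgtSets M q G B z, (S \ coloops M G).card = S.card - kColoops M G := by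
    intro S hS
    rw [Finset.card_sdiff_of_subset (hKS S hS), kColoops_eq_card_coloops]
  have hρ1 : ∀ S ∈ tgtSets M q G B z, ρ + 1 ≤ (S \ coloops M G).card := by
    intro S hS
    obtain ⟨-, hBS, hcard⟩ := mem_tgtSets.1 hS
    have hBS' : B ⊆ S := (Finset.subset_insert z B).trans hBS
    have hsub : (S \ B) ∪ (B \ coloops M G) ⊆ S \ coloops M G := by
      intro x hx
      rw [Finset.mem_union, Finset.mem_sdiff, Finset.mem_sdiff] at hx
      rw [Finset.mem_sdiff]
      rcases hx with ⟨hxS, hxB⟩ | ⟨hxB, hxK⟩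
      · exact ⟨hxS, fun h => hxB (hK h)⟩
      · exact ⟨hBS' hxB, hxK⟩
    have hdisj : Disjoint (S \ B) (B \ coloops M G) := by
      rw [Finset.disjoint_left]; intro x hx hx'
      exact (Finset.mem_sdiff.1 hx).2 (Finset.mem_sdiff.1 hx').1
    have := Finset.card_le_card hsub
    rw [Finset.card_union_of_disjoint hdisj] at this
    omega
  have hu : ∀ S ∈ tgtSets M q G B z, pi2Mass M q G S ≤ u S.card := by
    intro S hS
    have := pi2Mass_le_dgen hG hd hdq hk hkd (by omega) hc hlam.le hs hl S
    rw [hSK S hS] at this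
    simpa [hu_def, hn] using this
  have hv : ∀ S ∈ tgtSets M q G B z, v S.card ≤ cap2 M q G S := by
    intro S hS
    have hS' := (mem_tgtSets.1 hS).1
    have hSG : S ⊆ G := subset_G_of_mem_shadowAt hS'
    simp only [hv_def]
    split_ifs with hle
    · exact cap2_ge_cPrimeDG hG hd hdq hk hs hl hS' (hρ1 S hS)
    · push Not at hle
      have h1 : (G \ S).card ≤ q - d := by
        rw [Finset.card_sdiff_of_subset hSG]; omega
      exact (cap2_eq_one_of_card_le hG (by rw [hd]; omega)).ge
  have hv0 : ∀ S ∈ tgtSets M q G B z, 0 ≤ v S.card := by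
    intro S _
    simp only [hv_def]
    split_ifs
    · exact hc
    · exact zero_le_one
  have hinc := lossIncome_ge_of_bounds hG hd' hB hz hl0 u v hu hv hv0
  rw [hr, hb] at hinc
  have hsum' : ∑ j ∈ Finset.Icc 1 (n - ρ), ((n - ρ).choose j : ℚ) * (v (q + 1 + j) / u (q + 1 + j)) =
      ((2 ^ (n - ρ) - 1 : ℕ) : ℚ) * DGen.dgenSum n q d ρ (kColoops M G) := by
    unfold DGen.dgenSum
    rw [Finset.mul_sum]
    apply Finset.sum_congr rfl
    intro j hj
    rw [Finset.mem_Icc] at hj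
    have hv' : v (q + 1 + j) = DGen.cjDG n q d ρ (kColoops M G) j := by
      simp only [hv_def, DGen.cjDG]
      have hiff : q + 1 + j + (q - d + 1) ≤ G.card ↔ j + ρ + (q - d + 1) ≤ n := by omega
      by_cases hcj : j + ρ + (q - d + 1) ≤ n
      · rw [if_pos (hiff.2 hcj), if_pos hcj]
      · rw [if_neg (fun h => hcj (hiff.1 h)), if_neg hcj]
    have hu' : u (q + 1 + j) = ((ρ : ℚ) * ((j + ρ).choose ρ : ℚ)) *
        (lambdaDG q d ρ (kColoops M G) / ((2 ^ (n - ρ) - 1 : ℕ) : ℚ)) := by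
      simp only [hu_def]
      rw [show q + 1 + j - kColoops M G = j + ρ by omega]
    rw [hv', hu']
    have hjρ : (0 : ℚ) < ((j + ρ).choose ρ : ℚ) := by exact_mod_cast Nat.choose_pos (by omega)
    have hρ0 : (0 : ℚ) < (ρ : ℚ) := by exact_mod_cast (by omega : 0 < ρ)
    field_simp
  rw [hsum'] at hinc
  unfold rhoL
  rw [hT]
  have hl' : 0 < loss M q G B z := lt_of_le_of_ne (loss_nonneg' hG hd' B z) (Ne.symm hl0)
  calc loss M q G B z = loss M q G B z / ((2 ^ (n - ρ) - 1 : ℕ) : ℚ) * ((2 ^ (n - ρ) - 1 : ℕ) : ℚ) := by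
        field_simp
    _ ≤ loss M q G B z / ((2 ^ (n - ρ) - 1 : ℕ) : ℚ) *
          (((2 ^ (n - ρ) - 1 : ℕ) : ℚ) * DGen.dgenSum n q d ρ (kColoops M G)) := by
        apply mul_le_mul_of_nonneg_left _ (div_nonneg hl'.le hTpos.le)
        nlinarith [hsum, hTpos]
    _ ≤ loss M q G B z / ((2 ^ (n - ρ) - 1 : ℕ) : ℚ) * lossIncome M q G B z :=
        mul_le_mul_of_nonneg_left hinc (div_nonneg hl'.le hTpos.le)

/-! ## The target sum in closed form -/

namespace DGen

/-- `Aρt` and `Ttop` as rational sums. -/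
theorem cast_Aρt (n ρ t : ℕ) : (Aρt n ρ t : ℚ) = ∑ i ∈ Finset.Ico (ρ + 1) (n + 1 - t), (n.choose i : ℚ) := by
  unfold Aρt; push_cast; rfl

/-- `Ttop` as a rational sum. -/
theorem cast_Ttop (n t : ℕ) : (Ttop n t : ℚ) = ∑ i ∈ Finset.Ico (n + 1 - t) (n + 1), (n.choose i : ℚ) := by
  unfold Ttop; push_cast; rfl

/-- **The target sum in closed form** (`t = q − d + 1`, `n ≥ ρ + t`, `ρ ≥ 1`, `λ > 0`). -/
theorem dgenSum_eq {n q d ρ k : ℕ} (hn : ρ + (q - d + 1) ≤ n) (hρ : 1 ≤ ρ)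
    (hlam : 0 < lambdaDG q d ρ k) :
    dgenSum n q d ρ k =
      (cPrimeDG q d ρ k * (Aρt n ρ (q - d + 1) : ℚ) + (Ttop n (q - d + 1) : ℚ)) /
        ((ρ : ℚ) * lambdaDG q d ρ k * (n.choose ρ : ℚ)) := by
  set t := q - d + 1 with ht
  have hρ0 : (0 : ℚ) < (ρ : ℚ) := by exact_mod_cast hρ
  have hC : (0 : ℚ) < (n.choose ρ : ℚ) := by exact_mod_cast Nat.choose_pos (by omega)
  unfold dgenSum
  have hterm : ∀ j ∈ Finset.Icc 1 (n - ρ),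
      ((n - ρ).choose j : ℚ) * (cjDG n q d ρ k j / ((ρ : ℚ) * lambdaDG q d ρ k * ((j + ρ).choose ρ : ℚ))) =
      (1 / ((ρ : ℚ) * lambdaDG q d ρ k * (n.choose ρ : ℚ))) * (cjDG n q d ρ k j * (n.choose (j + ρ) : ℚ)) := by
    intro j _
    have h := DQm1.choose_div_eq_dqm1 (n := n) (ρ := ρ) (j := j) (by omega)
    have hj : (0 : ℚ) < ((j + ρ).choose ρ : ℚ) := by exact_mod_cast Nat.choose_pos (by omega)
    rw [show ((n - ρ).choose j : ℚ) * (cjDG n q d ρ k j / ((ρ : ℚ) * lambdaDG q d ρ k * ((j + ρ).choose ρ : ℚ))) =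
        (cjDG n q d ρ k j / ((ρ : ℚ) * lambdaDG q d ρ k)) * (((n - ρ).choose j : ℚ) / ((j + ρ).choose ρ : ℚ)) by
          field_simp, h]
    field_simp
  rw [Finset.sum_congr rfl hterm, ← Finset.mul_sum]
  have hsplit : ∑ j ∈ Finset.Icc 1 (n - ρ), cjDG n q d ρ k j * (n.choose (j + ρ) : ℚ) =
      cPrimeDG q d ρ k * (Aρt n ρ t : ℚ) + (Ttop n t : ℚ) := by
    have hIcc : Finset.Icc 1 (n - ρ) = Finset.Ico 1 (n - ρ + 1) := by
      ext j; simp only [Finset.mem_Icc, Finset.mem_Ico]; omega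
    rw [hIcc, ← Finset.sum_Ico_consecutive _ (by omega : 1 ≤ n + 1 - t - ρ) (by omega : n + 1 - t - ρ ≤ n - ρ + 1)]
    have hA : ∑ j ∈ Finset.Ico 1 (n + 1 - t - ρ), cjDG n q d ρ k j * (n.choose (j + ρ) : ℚ) =
        cPrimeDG q d ρ k * (Aρt n ρ t : ℚ) := by
      rw [cast_Aρt, Finset.mul_sum, Finset.sum_Ico_eq_sum_range, Finset.sum_Ico_eq_sum_range]
      rw [show n + 1 - t - (ρ + 1) = n + 1 - t - ρ - 1 by omega]
      apply Finset.sum_congr rfl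
      intro m hm
      rw [Finset.mem_range] at hm
      unfold cjDG
      rw [if_pos (by omega), show ρ + 1 + m = 1 + m + ρ by ring]
    have hB : ∑ j ∈ Finset.Ico (n + 1 - t - ρ) (n - ρ + 1), cjDG n q d ρ k j * (n.choose (j + ρ) : ℚ) =
        (Ttop n t : ℚ) := by
      rw [cast_Ttop, Finset.sum_Ico_eq_sum_range, Finset.sum_Ico_eq_sum_range]
      rw [show n - ρ + 1 - (n + 1 - t - ρ) = n + 1 - (n + 1 - t) by omega]
      apply Finset.sum_congr rfl
      intro m hm
      rw [Finset.mem_range] at hm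
      unfold cjDG
      rw [if_neg (by omega), show n + 1 - t - ρ + m + ρ = n + 1 - t + m by omega, one_mul]
    rw [hA, hB]
  rw [hsplit]
  field_simp

end DGen

end PercRepro.Shadow
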